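import Summits.ValiantsHypothesis.ValiantsHypothesis.Theorems.PrincipalMinorColouringBorderBoundedRankTwoDefs
import Summits.ValiantsHypothesis.ValiantsHypothesis.Theorems.PrincipalMinorColouringBorderBoundedRankTwoDenseCountCore

/-!
# Route PrincipalMinorColouring — item `BorderBoundedRank` (stmt-ValiantsHypothesis-3778, ∀ r): the counting half

The line `closure_counting` of the `r = 2` rung `BorderBoundedRankTwo` (stmt-21038; stubs `stub_transport`,
`stub_denseCount` landed) generalises verbatim to every FIXED class size `r` ("2 ↦ r" in the line card): colour
classes of size `≤ r` use at most `r·k` variable slots for `k` placed variables, so the transported coefficient vectors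
lie in the closure of the union of the normal-form images `range (nfMap k s ι)` over `s ≤ r·k`, and the closure-robust
Hrubeš–Joglekar count bounds `2^k` by the parameter count `1 + (2·r·k)²` of the largest normal form.

This file supplies the two definition-free ingredients of that generalisation on the counting side:
* `two_pow_le_of_dense_iUnion_nfMap m k` — if every `c : (Fin k → Bool) → ℂ` is in the closure of
  `⋃_{s ≤ m} ⋃_ι range (nfMap k s ι)`, then `2 ^ k ≤ 1 + (2m)²` (from the general
  `card_le_of_dense_of_subset_polynomialImages` and `eval_coeff_genericNormalForm` of
  `…BorderBoundedRankTwoDenseCountCore`; `m = 2k` is `stub_denseCount`);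
* `one_add_sq_lt_two_pow_slots r` — the choice `k(r) = 8(r+2)` of the number of placed variables beats the count:
  `1 + (2·r·k(r))² < 2^{k(r)}`.

Prover seat val-width-21038-p2 g0 (cell val-width). No definitions (`nfMap`, `monB` are the Theorems-side vocabulary of
`…BorderBoundedRankTwoDefs`). Closes NO item (`--supports stmt-ValiantsHypothesis-3778`). Calibration: for each fixed `r`
this stays inside Hrubeš–Joglekar's read-`k` range; not an open bound; `TotalRankNotQP` (stmt-3775) untouched;
VP ≠ VNP is not moved.
-/

-- `Summit.ValiantsHypothesis.ValiantsHypothesis.…` is the tree's mandated single-conjunct layout (Sub = Summit).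
set_option linter.dupNamespace false

namespace Summit.ValiantsHypothesis.ValiantsHypothesis.Theorems.BorderBoundedRankTwoClosureCounting

open MvPolynomial Matrix
open Summit.ValiantsHypothesis.ValiantsHypothesis.Theorems.PrincipalMinorColouring.ClosureCounting
  (card_le_of_dense_of_subset_polynomialImages eval_coeff_genericNormalForm)

/-- **Dense-image counting with at most `m` slots** (Hrubeš–Joglekar 2025, Thm. 2, border form): if every vector
`c : (Fin k → Bool) → ℂ` lies in the closure of the union of the normal-form images `range (nfMap k s ι)` over all
slot counts `s ≤ m` and all slot patterns `ι : Fin s → Fin k`, then `2 ^ k ≤ 1 + (2m)²` — each `nfMap k s ι` is a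
polynomial map in the `1 + (2s)² ≤ 1 + (2m)²` parameters `(a, H)`. (`m = 2k` is the registered `stub_denseCount`.)
[cite: HrubesJoglekar2025, Thm. 2 (p. 53:4)] -/
theorem two_pow_le_of_dense_iUnion_nfMap (m k : ℕ)
    (h : ∀ c : (Fin k → Bool) → ℂ, c ∈ closure (⋃ (s : Fin (m + 1)), ⋃ (ι : Fin (s : ℕ) → Fin k),
      Set.range (nfMap k s ι))) :
    2 ^ k ≤ 1 + (2 * m) ^ 2 := by
  classical
  have hcard := card_le_of_dense_of_subset_polynomialImages
    (I := Σ s : Fin (m + 1), (Fin (s : ℕ) → Fin k))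
    (π := fun i => Unit ⊕ ((Fin (i.1 : ℕ) ⊕ Fin (i.1 : ℕ)) × (Fin (i.1 : ℕ) ⊕ Fin (i.1 : ℕ))))
    (fun i r => coeff (monB r)
      (sumAlgEquiv ℂ (Fin k) (Unit ⊕ ((Fin (i.1 : ℕ) ⊕ Fin (i.1 : ℕ)) × (Fin (i.1 : ℕ) ⊕ Fin (i.1 : ℕ))))
        (X (Sum.inr (Sum.inl ())) *
          (diagonal (Sum.elim (fun q => X (Sum.inl (i.2 q))) 0) +
            Matrix.of fun a b => X (Sum.inr (Sum.inr (a, b)))).det)))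
    (N := 1 + (2 * m) ^ 2) ?_ _ ?_ h
  · simpa [Fintype.card_fun, Fintype.card_bool, Fintype.card_fin] using hcard
  · -- parameter count: `1 + (2s)² ≤ 1 + (2m)²` for `s ≤ m`
    rintro ⟨s, ι⟩
    have h2 : (s : ℕ) + s ≤ 2 * m := by omega
    calc Fintype.card (Unit ⊕ ((Fin (s : ℕ) ⊕ Fin (s : ℕ)) × (Fin (s : ℕ) ⊕ Fin (s : ℕ))))
        = 1 + ((s : ℕ) + s) * ((s : ℕ) + s) := by
          simp [Fintype.card_sum, Fintype.card_prod, Fintype.card_fin, Fintype.card_unique]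
      _ ≤ 1 + (2 * m) * (2 * m) := Nat.add_le_add_left (Nat.mul_le_mul h2 h2) 1
      _ = 1 + (2 * m) ^ 2 := by rw [pow_two]
  · -- every point of the union is a value of the corresponding generic coefficient map
    intro v hv
    simp only [Set.mem_iUnion, Set.mem_range] at hv
    obtain ⟨s, ι, p, rfl⟩ := hv
    refine ⟨⟨s, ι⟩, Sum.elim (fun _ => p.1) (fun ab => p.2 ab.1 ab.2), ?_⟩
    funext r
    exact eval_coeff_genericNormalForm ι _ p.1 p.2

/-- **The number of placed variables beats the count**: with `k(r) = 8(r+2)` variables,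
`1 + (2·r·k(r))² < 2^{k(r)}` (since `r(r+2) < (2^{r+2})²`, so `256·(r(r+2))² < 2^8 · 2^{4(r+2)} ≤ 2^{8(r+2)}`).
[folklore] -/
theorem one_add_sq_lt_two_pow_slots (r : ℕ) : 1 + (2 * (r * (8 * (r + 2)))) ^ 2 < 2 ^ (8 * (r + 2)) := by
  have hB : r + 2 < 2 ^ (r + 2) := Nat.lt_two_pow_self
  have hA : r * (r + 2) < 2 ^ (r + 2) * 2 ^ (r + 2) :=
    calc r * (r + 2) ≤ (r + 2) * (r + 2) := Nat.mul_le_mul_right _ (by omega)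
      _ < 2 ^ (r + 2) * 2 ^ (r + 2) := Nat.mul_self_lt_mul_self hB
  have hA2 : (r * (r + 2)) ^ 2 < (2 ^ (r + 2) * 2 ^ (r + 2)) ^ 2 := Nat.pow_lt_pow_left hA (by norm_num)
  have hpow : (2 ^ (r + 2) * 2 ^ (r + 2)) ^ 2 * 256 ≤ 2 ^ (8 * (r + 2)) := by
    rw [← pow_add, ← pow_mul, show (256 : ℕ) = 2 ^ 8 by norm_num, ← pow_add]
    exact Nat.pow_le_pow_right (by norm_num) (by omega)
  have hsq : (2 * (r * (8 * (r + 2)))) ^ 2 = (r * (r + 2)) ^ 2 * 256 := by ring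
  rw [hsq]
  omega

end Summit.ValiantsHypothesis.ValiantsHypothesis.Theorems.BorderBoundedRankTwoClosureCounting
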